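import Summits.CriticalPhenomena.PercolationContinuityZ3.Theorems.Transplant.SkelFrmFromBParamsSlotsRS
import Summits.CriticalPhenomena.PercolationContinuityZ3.Theorems.Transplant.SkelFrmBParamsSlotsRS
import Summits.CriticalPhenomena.PercolationContinuityZ3.Theorems.Transplant.SkelFrmFromBParamsRootA
import Summits.CriticalPhenomena.PercolationContinuityZ3.Theorems.Transplant.SkelFrmBParamsRootA
import Summits.CriticalPhenomena.PercolationContinuityZ3.Theorems.Transplant.SkelFrmFromBChoiceNums
import Summits.CriticalPhenomena.PercolationContinuityZ3.Theorems.Transplant.SkelFrmBChoiceNums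
import Summits.CriticalPhenomena.PercolationContinuityZ3.Theorems.Transplant.PlanarSkeletonFrmFromDefs
import Summits.CriticalPhenomena.PercolationContinuityZ3.Theorems.Transplant.PlanarSkeletonFrmDefs
import Summits.CriticalPhenomena.PercolationContinuityZ3.Theorems.Transplant.SkelPhiStepIDataNS
import HarnessLib
import Summits.CriticalPhenomena.PercolationContinuityZ3.Theorems.Transplant.SkelFrmBParamsBridgeF
/-!
# U-WAVE PORT (RULING D-U, lead g21 2026-08-26; WAVE-U-MANIFEST v3.1 row «SkelFrmBParamsBridgeF» ↦ «SkelFrmFromBParamsBridgeF») of the tree module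
# `Transplant/SkelFrmBParamsBridgeF` onto the carrier `PlanarSkeletonFrmFrom` (frames only, cylinders connected from width `ℓ₀` on)

ORIGINAL TITLE: N2 (frames-only node `SamePDropOfSkeletonFrmFrom₁`, OPEN), (F) value layer — part BridgeF: **THE WIDE BRIDGE PAIR FOR THE y′-FACE AT THE (S0) KIT LEVELS**

builds on p205010 (kernel theorem, internal audit signed; external expert review pending) — nothing in this file uses p205010; NOTHING is claimed about the
OPEN node U `SamePDropOfSkeletonFrmFrom₁` (nor U_s / the end state).  Lane `prim-bschramm`, seat `prim-bschramm-stmt` gen 26 (port pen, RULING M-11 family P-stmt; tool = p3-g26's port_u.py of record, registry-driven inputs); helper file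
(`--supports stmt-CriticalPhenomena-4575 --as helper`).  PORT RULES r1–r4 of RULING D-U: declaration order and proof texts are those of the original,
byte-identical except (i) the carrier token `PlanarSkeletonFrm ↦ PlanarSkeletonFrmFrom` (binders, `namespace`/`end` lines, qualified names of twinned
declarations), (ii) carrier-FREE declarations of the original (φ-level `Skelφ…` blocks and namespace-only arithmetic residents) are NOT re-declared —
this file imports the original and `export`s the twin-free residents (POLICY T / treatment (m1)); residents whose statement mentions a twinned
constant are copied, (iii) every carrier-binding declaration keeps its explicit binder `(Φ : PlanarSkeletonFrmFrom G)` in its own signature (r2).  Docstrings and citations are the original's.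
-/

noncomputable section

open scoped Classical

namespace Summit.CriticalPhenomena.PercolationContinuityZ3.Theorems.Transplant

namespace PlanarSkeletonFrmFrom

namespace NegB

open Literature.Probability.Percolation Literature.Probability.LatticeModels SimpleGraph
open SkelConc (Consts)
open Skelφ.StepI (DataN)
open Neg

namespace KS

section BridgeF

/-- **The y′-face bridge clearance** `bF c := M_u + (c+2)·RA′ + 1`. [this work] -/
def bF (κ : Consts) {V : Type} [DecidableEq V] [Countable V] {G : SimpleGraph V} [G.LocallyFinite] (Φ : PlanarSkeletonFrmFrom G) (t : V) (p : unitInterval) (D : Skelφ.StepI.DataNS V) (c : ℕ) (mk : ℕ) : ℕ := Mu D + (c + 2) * KS0.R'0 κ Φ t p D mk + 1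

/-- **The y′-face bridge zone-index floor** `mbF c := max (2·bF + 26) (24·M_u + 63)`. [this work] -/
def mbF (κ : Consts) {V : Type} [DecidableEq V] [Countable V] {G : SimpleGraph V} [G.LocallyFinite] (Φ : PlanarSkeletonFrmFrom G) (t : V) (p : unitInterval) (D : Skelφ.StepI.DataNS V) (c : ℕ) (mk : ℕ) : ℕ := max (2 * bF κ Φ t p D c mk + 26) (24 * Mu D + 63)

/-- The y′-face bridge zone index `MBF := MB D mbF`. [this work] -/
abbrev MBF (κ : Consts) {V : Type} [DecidableEq V] [Countable V] {G : SimpleGraph V} [G.LocallyFinite] (Φ : PlanarSkeletonFrmFrom G) (t : V) (p : unitInterval) (D : Skelφ.StepI.DataNS V) (c : ℕ) (mk : ℕ) : ℕ := MB D (mbF κ Φ t p D c mk)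

/-- The y′-face bridge width `nBF := nB D mbF bF`. [this work] -/
abbrev nBF (κ : Consts) {V : Type} [DecidableEq V] [Countable V] {G : SimpleGraph V} [G.LocallyFinite] (Φ : PlanarSkeletonFrmFrom G) (t : V) (p : unitInterval) (D : Skelφ.StepI.DataNS V) (c : ℕ) (mk : ℕ) : ℕ := nB D (mbF κ Φ t p D c mk) (bF κ Φ t p D c mk)

/-- The y′-face bridge shear. [this work] -/
abbrev hBF (κ : Consts) {V : Type} [DecidableEq V] [Countable V] {G : SimpleGraph V} [G.LocallyFinite] (Φ : PlanarSkeletonFrmFrom G) (t : V) (p : unitInterval) (D : Skelφ.StepI.DataNS V) (c : ℕ) (mk : ℕ) : ℤ := hB t D (mbF κ Φ t p D c mk) (bF κ Φ t p D c mk)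

/-- The y′-face bridge half-length. [this work] -/
abbrev ℓBF (κ : Consts) {V : Type} [DecidableEq V] [Countable V] {G : SimpleGraph V} [G.LocallyFinite] (Φ : PlanarSkeletonFrmFrom G) (t : V) (p : unitInterval) (D : Skelφ.StepI.DataNS V) (c : ℕ) (mk : ℕ) : ℕ := ℓB t D (mbF κ Φ t p D c mk) (bF κ Φ t p D c mk)

/-- The y′-face bridge split point. [this work] -/
abbrev vBF (κ : Consts) {V : Type} [DecidableEq V] [Countable V] {G : SimpleGraph V} [G.LocallyFinite] (Φ : PlanarSkeletonFrmFrom G) (t : V) (p : unitInterval) (D : Skelφ.StepI.DataNS V) (c : ℕ) (mk : ℕ) : ℤ := vB t D (mbF κ Φ t p D c mk) (bF κ Φ t p D c mk)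

/-- `bF = M_u + (c+2)RA′ + 1`, `M_u ≤ bF`, `(c+2)·RA′ + 1 ≤ bF`, `bR ≤ bF` once `D.k ≤ M_u + c·RA′`. [folklore] -/
theorem bF_facts (κ : Consts) {V : Type} [DecidableEq V] [Countable V] {G : SimpleGraph V} [G.LocallyFinite] (Φ : PlanarSkeletonFrmFrom G) (t : V) (p : unitInterval) (D : Skelφ.StepI.DataNS V) (c : ℕ) (mk : ℕ) : bF κ Φ t p D c mk = Mu D + (c + 2) * KS0.R'0 κ Φ t p D mk + 1 ∧ Mu D ≤ bF κ Φ t p D c mk ∧ (c + 2) * KS0.R'0 κ Φ t p D mk + 1 ≤ bF κ Φ t p D c mk :=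
  ⟨rfl, by unfold bF; omega, by unfold bF; omega⟩

/-- `2·bF + 26 ≤ mbF` and `24·M_u + 63 ≤ mbF`. [folklore] -/
theorem mbF_floors (κ : Consts) {V : Type} [DecidableEq V] [Countable V] {G : SimpleGraph V} [G.LocallyFinite] (Φ : PlanarSkeletonFrmFrom G) (t : V) (p : unitInterval) (D : Skelφ.StepI.DataNS V) (c : ℕ) (mk : ℕ) : 2 * bF κ Φ t p D c mk + 26 ≤ mbF κ Φ t p D c mk ∧ 24 * Mu D + 63 ≤ mbF κ Φ t p D c mk := ⟨le_max_left _ _, le_max_right _ _⟩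

/-- **(R-F2) at the y′-face bridge**: `bF ≤ nBF`, `MBF < nBF`, `MBF + bF + 2 + ρz ≤ nBF`. [folklore] -/
theorem RF2F (κ : Consts) {V : Type} [DecidableEq V] [Countable V] {G : SimpleGraph V} [G.LocallyFinite] (Φ : PlanarSkeletonFrmFrom G) (t : V) (p : unitInterval) (D : Skelφ.StepI.DataNS V) (c : ℕ) (mk : ℕ) : bF κ Φ t p D c mk ≤ nBF κ Φ t p D c mk ∧ MBF κ Φ t p D c mk < nBF κ Φ t p D c mk ∧ MBF κ Φ t p D c mk + bF κ Φ t p D c mk + 2 + ρz D ≤ nBF κ Φ t p D c mk :=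
  ⟨(nB_facts D _ _).2.2.1, (nB_facts D _ _).2.1, (nB_facts D _ _).2.2.2⟩

/-- **The zone-index floors at the y′-face bridge**: `2·bF + 26 ≤ MBF`, `24·M_u + 63 ≤ MBF`, `M_u ≤ MBF`. [folklore] -/
theorem MBF_floors (κ : Consts) {V : Type} [DecidableEq V] [Countable V] {G : SimpleGraph V} [G.LocallyFinite] (Φ : PlanarSkeletonFrmFrom G) (t : V) (p : unitInterval) (D : Skelφ.StepI.DataNS V) (c : ℕ) (mk : ℕ) : 2 * bF κ Φ t p D c mk + 26 ≤ MBF κ Φ t p D c mk ∧ 24 * Mu D + 63 ≤ MBF κ Φ t p D c mk ∧ Mu D ≤ MBF κ Φ t p D c mk := by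
  have h1 := (MB_facts D (mbF κ Φ t p D c mk)).2.1
  have h2 := mbF_floors κ Φ t p D c mk
  exact ⟨h2.1.trans h1, h2.2.trans h1, (MB_facts D _).1⟩

/-- **The y′-face bridge pair is admissible.** [folklore] -/
theorem bridgeF_adm (κ : Consts) {V : Type} [DecidableEq V] [Countable V] {G : SimpleGraph V} [G.LocallyFinite] (Φ : PlanarSkeletonFrmFrom G) (t : V) (p : unitInterval) (D : Skelφ.StepI.DataNS V) (c : ℕ) (mk : ℕ) : D.M₀ ≤ (MBF κ Φ t p D c mk, nBF κ Φ t p D c mk).1 ∧ D.n₁ (MBF κ Φ t p D c mk, nBF κ Φ t p D c mk).1 ≤ (MBF κ Φ t p D c mk, nBF κ Φ t p D c mk).2 :=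
  bridge_adm D _ _

/-- **`2·bF + 27 ≤ ℓBF`** from the bridge pair's geometric clause (any map `ψ`). [folklore] -/
theorem ℓBF_ge (κ : Consts) {V : Type} [DecidableEq V] [Countable V] {G : SimpleGraph V} [G.LocallyFinite] (Φ : PlanarSkeletonFrmFrom G) (t : V) (p : unitInterval) (D : Skelφ.StepI.DataNS V) (c : ℕ) (mk : ℕ) (ψ : V → Site 2) (hE : D.EqGeom G ψ t (MBF κ Φ t p D c mk) (nBF κ Φ t p D c mk)) : 2 * bF κ Φ t p D c mk + 27 ≤ ℓBF κ Φ t p D c mk := by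
  have h1 := ℓB_ge t D (mbF κ Φ t p D c mk) (bF κ Φ t p D c mk) ψ hE
  have h2 := (mbF_floors κ Φ t p D c mk).1
  show _ ≤ ℓB t D (mbF κ Φ t p D c mk) (bF κ Φ t p D c mk)
  omega

/-- **THE CLEARANCE THE WIDE BRIDGE BUYS**: `M_u + (c+1)·RA′ < nBF − RA′` — with `R′s ≤ RA′` the y′-run's α-recession `(k+1)·R′s` (p1-g13's recession lemma) stays
clear of the zone scale `M_u` for every region `k ≤ c − 1` from the `k = 0` origin at the top of the `hxaY` interval (`c_lo(core1) − n_L = nBF − RA′`). [folklore] -/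
theorem clearF (κ : Consts) {V : Type} [DecidableEq V] [Countable V] {G : SimpleGraph V} [G.LocallyFinite] (Φ : PlanarSkeletonFrmFrom G) (t : V) (p : unitInterval) (D : Skelφ.StepI.DataNS V) (c : ℕ) (mk : ℕ) : ((Mu D : ℕ) : ℤ) + ((c : ℤ) + 1) * (KS0.R'0 κ Φ t p D mk : ℤ) < (nBF κ Φ t p D c mk : ℤ) - KS0.R'0 κ Φ t p D mk := by
  have h1 := (RF2F κ Φ t p D c mk).1
  have h2 := (bF_facts κ Φ t p D c mk).1
  have h3 : Mu D + (c + 2) * KS0.R'0 κ Φ t p D mk + 1 ≤ nBF κ Φ t p D c mk := by rw [← h2]; exact h1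
  have h4 : ((Mu D + (c + 2) * KS0.R'0 κ Φ t p D mk + 1 : ℕ) : ℤ) ≤ (nBF κ Φ t p D c mk : ℤ) := by exact_mod_cast h3
  push_cast at h4
  linarith

/-- **THE EXTRA-PAIR SLOT CARRYING THE y′-FACE BRIDGE** `PxF c mk := {(MBF, nBF)}` (with admissibility). [this work] -/
def PxF (c : ℕ) (mk : ℕ) : PSlot := fun κ _ _ _ _ _ Φ t p D =>
  ⟨{(MBF κ Φ t p D c mk, nBF κ Φ t p D c mk)}, fun q hq => by rw [Finset.mem_singleton] at hq; subst hq; exact bridgeF_adm κ Φ t p D c mk⟩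

/-- The y′-face bridge pair is in `PR mk (PxF c mk)` (and in `PR mk Px` for every `Px ⊇ PxF`'s pairs — here the exact slot). [folklore] -/
theorem mem_PxF (κ : Consts) {V : Type} [DecidableEq V] [Countable V] {G : SimpleGraph V} [G.LocallyFinite] (Φ : PlanarSkeletonFrmFrom G) (t : V) (p : unitInterval) (D : Skelφ.StepI.DataNS V) (c : ℕ) (mk : ℕ) : (MBF κ Φ t p D c mk, nBF κ Φ t p D c mk) ∈ (PR mk (PxF c mk) κ Φ t p D).1 := by
  show _ ∈ ({(MBR κ Φ t p D mk, nBR κ Φ t p D mk), (MK D mk, nKit D mk)} ∪ ({(MBF κ Φ t p D c mk, nBF κ Φ t p D c mk)} : Finset (ℕ × ℕ)))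
  exact Finset.mem_union_right _ (Finset.mem_singleton_self _)

end BridgeF

end KS

end NegB

end PlanarSkeletonFrmFrom

end Summit.CriticalPhenomena.PercolationContinuityZ3.Theorems.Transplant

end
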